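import Summits.Ventures.YMGap.Thresholds.StateLipschitzRows
import Summits.Ventures.YMGap.Thresholds.PlaquetteEnergyVariance
import Summits.Ventures.YMGap.Thresholds.StarMassGapDimRows
import HarnessLib

/-!
# Venture YMGap — THE STRONG-COUPLING WINDOW IS REGULAR: one bundling currency for the four typed no-transition
# signatures (one phase with exponential clustering; state locally Lipschitz in the coupling; finite plaquette
# susceptibility; extensive energy-variance bound), with hypothesis-free instances

HONEST FRAMING: venture file of the cell `pub-ymgap` (QuantumFields programme), seat ds-1.  ONE definition (nothing asserted by it)
and instance THEOREMS for `SU(N)` lattice Yang–Mills on `ℤ^d` with the Wilson action, inside ONE-SIDED strong-coupling windows.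
«Regular» bundles exactly the four statements the tree types today: (i) the cell's `MassGapAt d N β` (unique DLR state,
exponential clustering of Lipschitz cylinder covariances); (ii) C-LIP — the DLR state is LOCALLY LIPSCHITZ IN THE COUPLING in the
Kantorovich–Rubinstein form (`StateLipschitz`); (iii) C-SUS — the plaquette–plaquette covariances are absolutely summable, one
bound for all base plaquettes (`PlaquetteSusceptibility`); (iv) the variance of the plaquette energy of any finite region is at
most `χ · #plaquettes` (`PlaquetteEnergyVariance`).  These are lattice analogues of «no latent heat, no divergent specific heat»
INSIDE the window; Lipschitz / summable, NOT `C¹` / analytic; nothing about larger couplings, the continuum, or the Clay problem.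

* `StrongCouplingRegularAt d N β` — the definition.
* `su2_strongCouplingRegularAt` — `SU(2)`, `d = 4`, HYPOTHESIS-FREE at every 't Hooft `β = β_W/4` with `0 ≤ β_W < 2/9`
  (quarter modulus for C-LIP; the cell's `MassGapAt` rows for (i), (iii), (iv)).
* `strongCouplingRegularAt_SU` — every `N ≥ 2`, every `d ≥ 2`, HYPOTHESIS-FREE at every 't Hooft `|β| < 1/(16(d−1))`
  (Bakry–Émery modulus; `StarDimMassGap.massGapAt_SU_of_abs_le` for (i)).

References (mechanism): H. Föllmer, LNM 1362 (1988), Ch. I (2.8); H. Shen, R. Zhu, X. Zhu, CMP 400 (2023), Cor. 1.6; B. Simon,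
*The Statistical Mechanics of Lattice Gases* I (1993), §II.12.
-/

noncomputable section

open MeasureTheory Function Finset ProbabilityTheory Real
open scoped NNReal
open Literature.Probability.LatticeModels
open Literature.Probability.LatticeModels.DobrushinMetric
open Literature.MathematicalPhysics.QuantumLattice
open Literature.MathematicalPhysics.QuantumFieldTheory hiding ZdEdge Site
open Literature.MathematicalPhysics.QuantumFieldTheory.Balaban1983to89.StrongCouplingDobrushinWindow

namespace Summit.Ventures.YMGap.StrongCouplingRegular

variable (d N : ℕ)

/-- **The strong-coupling window is REGULAR at 't Hooft coupling `β`** for `SU(N)` lattice Yang–Mills on `ℤ^d` (bare coupling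
`N β` of `ymSpecification (fundamentalRep (Fin N)) (N β)`): (i) `MassGapAt d N β`; (ii) C-LIP — there are `L` and `r > 0` such
that for every `β'` with `|β' − β| < r`, all DLR states `μ` at `β` and `ν` at `β'`, and every bounded measurable `f` depending on
a finite link set `Δ` with Frobenius-Lipschitz vector `δ`: `|∫ f dμ − ∫ f dν| ≤ L |β − β'| Σ_{y∈Δ} δ_y`; (iii) C-SUS — for every
DLR state `μ` at `β` one `χ` with `Σ_q |Cov_μ(W_p, W_q)| ≤ χ` (summable over all plaquettes `q`) for every plaquette `p`,
`W_p = (1/N) Re tr U_p`; (iv) for every DLR state `μ` at `β` one `χ` with `Var_μ(Σ_{p∈P} W_p) ≤ χ · #P` for every finite set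
`P` of plaquettes.  HONEST LABEL (rb-theory countersign 2026-08-23T07:03:51Z, verbatim): «regular = (i) `MassGapAt` ∧ (ii) locally
Lipschitz in the coupling (∃ L r) ∧ (iii) summable plaquette covariances ∧ (iv) extensive energy variance — Lipschitz / summable, NOT
C¹ / analytic; lattice, one-sided strong-coupling window; nothing continuum / Clay».  Nothing is asserted by the definition. -/
def StrongCouplingRegularAt (β : ℝ) : Prop :=
  MassGapAt d N β ∧
    (∃ L r : ℝ, 0 < r ∧ ∀ β' : ℝ, |β' - β| < r →
      ∀ μ ∈ ymGibbsMeasures (d := d) (fundamentalRep (Fin N)) (N * β),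
      ∀ ν ∈ ymGibbsMeasures (d := d) (fundamentalRep (Fin N)) (N * β'),
      ∀ (f : LGConfig d (Matrix.specialUnitaryGroup (Fin N) ℂ) → ℝ) (Δ : Finset (ZdEdge d)) (M : ℝ)
        (δ : ZdEdge d → ℝ), Measurable f → DependsOn f (↑Δ : Set (ZdEdge d)) → (∀ σ, |f σ| ≤ M) →
        IsLipBound suFrobDist f δ →
          |(∫ σ, f σ ∂μ) - ∫ σ, f σ ∂ν| ≤ L * |β - β'| * ∑ y ∈ Δ, δ y) ∧
    (∀ μ ∈ ymGibbsMeasures (d := d) (fundamentalRep (Fin N)) (N * β), ∃ χ : ℝ, ∀ p : ZdPlaquette d,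
      Summable (fun q : ZdPlaquette d => |cov[zdPlaquetteObs (fundamentalRep (Fin N)) p.1 p.2.1.1 p.2.1.2,
        zdPlaquetteObs (fundamentalRep (Fin N)) q.1 q.2.1.1 q.2.1.2; μ]|) ∧
      ∑' q : ZdPlaquette d, |cov[zdPlaquetteObs (fundamentalRep (Fin N)) p.1 p.2.1.1 p.2.1.2,
        zdPlaquetteObs (fundamentalRep (Fin N)) q.1 q.2.1.1 q.2.1.2; μ]| ≤ χ) ∧
    (∀ μ ∈ ymGibbsMeasures (d := d) (fundamentalRep (Fin N)) (N * β), ∃ χ : ℝ, ∀ P : Finset (ZdPlaquette d),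
      Var[fun U => ∑ p ∈ P, zdPlaquetteObs (fundamentalRep (Fin N)) p.1 p.2.1.1 p.2.1.2 U; μ] ≤ χ * P.card)

variable {d N}

/-- **`SU(2)`, `d = 4`: the window `|β| < 1/18` ('t Hooft; Wilson `|β_W| < 2/9`) is regular**, hypothesis-free, two-sided:
(i) `MassGapAt 4 2 β` is the cell's row `ImprovedThresholdStar.su2_massGapAt_of_abs_le` (`1/18 ≤ 9/100`); (ii) C-LIP from
`StateLipschitz.abs_integral_sub_integral_le_of_oneLinkKRModulus` with the quarter modulus `OneLinkKRModulus 2 1 1`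
(`SlabAreaLawDimensions.su2_oneLinkKRModulus_one_one`): `L = 6√2/(1 − 18|β|)`, `r = 1/6 − |β|`; (iii), (iv) the C-SUS corollaries of (i). -/
theorem su2_strongCouplingRegularAt {β : ℝ} (hβ : |β| < 1 / 18) : StrongCouplingRegularAt 4 2 β := by
  have hgap : MassGapAt 4 2 β := ImprovedThresholdStar.su2_massGapAt_of_abs_le (by linarith)
  refine ⟨hgap, ?_, ?_, ?_⟩
  · refine ⟨1 * (2 * (((4 : ℕ) : ℝ) - 1) * Real.sqrt ((2 : ℕ) : ℝ)) / (1 - 6 * (((4 : ℕ) : ℝ) - 1) * |β| * 1),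
      1 / 6 - |β|, by linarith, ?_⟩
    intro β' hβ' μ hμ ν hν f Δ M δ hfm hfdep hM hδ
    have hR : |β| * (2 * (((4 : ℕ) : ℝ) - 1)) ≤ 1 := by push_cast; linarith
    have hR' : |β'| * (2 * (((4 : ℕ) : ℝ) - 1)) ≤ 1 := by
      have : |β'| ≤ |β| + |β' - β| := by
        have h := abs_add_le β (β' - β); simp only [add_sub_cancel] at h; exact h
      push_cast; linarith
    have hs : 6 * (((4 : ℕ) : ℝ) - 1) * |β| * 1 < 1 := by push_cast; linarith
    have key := StateLipschitz.abs_integral_sub_integral_le_of_oneLinkKRModulus (d := 4) (N := 2) (by norm_num) le_rfl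
      zero_le_one hR hR' SlabAreaLawDimensions.su2_oneLinkKRModulus_one_one hs hμ hν hfm hfdep hM hδ
    refine key.trans (le_of_eq ?_)
    ring
  · intro μ hμ
    exact PlaquetteSusceptibility.summable_abs_cov_plaquette_of_massGapAt (by norm_num) hgap hμ
  · intro μ hμ
    exact PlaquetteEnergyVariance.variance_sum_plaquette_le_of_massGapAt (by norm_num) hgap hμ

/-- Wilson units: for `0 ≤ β_W < 2/9`, `StrongCouplingRegularAt 4 2 (β_W/4)`. -/
theorem su2_strongCouplingRegularAt_wilson {βW : ℝ} (h0 : 0 ≤ βW) (h29 : βW < 2 / 9) :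
    StrongCouplingRegularAt 4 2 (βW / 4) :=
  su2_strongCouplingRegularAt (by rw [abs_of_nonneg (by positivity)]; linarith)

/-- **Every `SU(N)`, `N ≥ 2`, every `d ≥ 2`: Shen–Zhu–Zhu's window `|β| < 1/(16(d−1))` is regular**, hypothesis-free:
(i) `StarDimMassGap.massGapAt_SU_of_abs_le` (`|β|(d−1) ≤ 1/12`); (ii) C-LIP from the Bakry–Émery row
`StateLipschitzRows.abs_integral_sub_integral_le_SU` at `b₀ = (|β| + 1/(16(d−1)))/2`, radius `r = b₀ − |β|`;
(iii), (iv) the C-SUS corollaries of (i). [cite: arXiv220412737, Lemma 4.1 with (4.7)-(4.8), Cor. 4.4 (4.11) and Rem. 1.3] -/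
theorem strongCouplingRegularAt_SU (hd : 2 ≤ d) (hN : 2 ≤ N) {β : ℝ} (hβ : |β| < 1 / (16 * ((d : ℝ) - 1))) :
    StrongCouplingRegularAt d N β := by
  have hd2 : (2 : ℝ) ≤ d := by exact_mod_cast hd
  have hd0 : (0 : ℝ) < (d : ℝ) - 1 := by linarith
  have h16 : |β| * (16 * ((d : ℝ) - 1)) < 1 := (lt_div_iff₀ (by positivity)).1 hβ
  have hgap : MassGapAt d N β := StarDimMassGap.massGapAt_SU_of_abs_le hd hN (by nlinarith [abs_nonneg β])
  refine ⟨hgap, ?_, ?_, ?_⟩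
  · set b₀ : ℝ := (|β| + 1 / (16 * ((d : ℝ) - 1))) / 2 with hb₀
    have hb₀lt : b₀ < 1 / (16 * ((d : ℝ) - 1)) := by rw [hb₀]; linarith
    have hβb₀ : |β| < b₀ := by rw [hb₀]; linarith
    refine ⟨2 * ((d : ℝ) - 1) * Real.sqrt N / (1 / 2 - 8 * ((d : ℝ) - 1) * b₀), b₀ - |β|, by linarith, ?_⟩
    intro β' hβ' μ hμ ν hν f Δ M δ hfm hfdep hM hδ
    have hβ'b₀ : |β'| ≤ b₀ := by
      have : |β'| ≤ |β| + |β' - β| := by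
        have h := abs_add_le β (β' - β); simp only [add_sub_cancel] at h; exact h
      linarith
    have key := StateLipschitzRows.abs_integral_sub_integral_le_SU hd hN hb₀lt hβb₀.le hβ'b₀ hμ hν hfm hfdep hM hδ
    refine key.trans (le_of_eq ?_)
    ring
  · intro μ hμ
    exact PlaquetteSusceptibility.summable_abs_cov_plaquette_of_massGapAt (by omega) hgap hμ
  · intro μ hμ
    exact PlaquetteEnergyVariance.variance_sum_plaquette_le_of_massGapAt (by omega) hgap hμ

end Summit.Ventures.YMGap.StrongCouplingRegular

end
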